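import Summits.Ventures.QEC.CircuitDistance.SchedStructure
import HarnessLib

/-!
# Q4 lane, ₛ-spine (3): COLUMN FORMULAS of a single fault, for any CNOT order
# (venture QEC, experiment cell CDX; drafted by qec-cdx-idea-2 g2, typed by qec-cdx-type-2, statement audit qec-cdx-crit-1
# (director-qec R158); the `PortColumns.lean` layer of record re-pointed from `cycleEvents` to `cycleEventsₛ σ` under `hσ : σ.CycleFacts S`; proofs verbatim with `run1_eq ↦ run1ₛ_eq'`,
# `shape ↦ shapeₛ σ S`, `dataX_singleton ↦ dataXₛ_singleton`; nothing here asserts a value of `d_circ`)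

* `run1ₛ_mZ` / `run1ₛ_mX`: the outcome-flip components of the structure theorem;
* `decide_HZ_dataXₛ_singleton` / `decide_HX_dataZₛ_singleton`: the final-layer term of one fault is its residual's true syndrome;
* **`detZₛ_singleton`**, **`detXₛ_singleton`**: the detectors fired by one fault of cycle `c ∈ [1, Nc]` — layers `c`, `c+1`
  (and `c+2` for the `ζ`-term of an `InitZ` fault), two-layer locality, independent of `Nc` except through `[c+1 ≤ Nc]·ζ`.
Generic in `σ` and `S`.
-/

namespace Summit.Ventures.QEC.CircuitDistance

open Literature.InformationTheory.QuantumCodes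

variable {ℓ m : ℕ} [NeZero ℓ] [NeZero m]

/-! ## Column formulas for single faults -/

/-- The `Z`-outcome flips of one fault (structure theorem, `mZ` component). -/
theorem run1ₛ_mZ {σ : SMSchedule} {S : SMCode ℓ m} (hσ : σ.CycleFacts S) (Nc : ℕ) (f : Fault ℓ m) (h₁ : 1 ≤ f.cyc) (h₂ : f.cyc ≤ Nc) (t : ℕ) (j : BB.Mono ℓ m) :
    (Gen.run1 S (allEventsₛ σ Nc) f).mZ t j = if f.cyc < t ∧ t ≤ Nc then
        xor (if t = f.cyc + 1 then (shapeₛ σ S f).frame.ancZx j else false) (synZ S (shapeₛ σ S f).frame.dataXb j)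
      else (shapeₛ σ S f).mZ t j := by
  rw [run1ₛ_eq' hσ Nc f h₁ h₂]; rfl

/-- The `X`-outcome flips of one fault (structure theorem, `mX` component). -/
theorem run1ₛ_mX {σ : SMSchedule} {S : SMCode ℓ m} (hσ : σ.CycleFacts S) (Nc : ℕ) (f : Fault ℓ m) (h₁ : 1 ≤ f.cyc) (h₂ : f.cyc ≤ Nc) (t : ℕ) (i : BB.Mono ℓ m) :
    (Gen.run1 S (allEventsₛ σ Nc) f).mX t i = if f.cyc < t ∧ t ≤ Nc then synX S (shapeₛ σ S f).frame.dataZb i else (shapeₛ σ S f).mX t i := by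
  rw [run1ₛ_eq' hσ Nc f h₁ h₂]; rfl

/-- The final-layer `Z`-detector term of one fault is its residual's true syndrome `synZ`. -/
theorem decide_HZ_dataXₛ_singleton {σ : SMSchedule} {S : SMCode ℓ m} (hσ : σ.CycleFacts S) (Nc : ℕ) (f : Fault ℓ m) (h₁ : 1 ≤ f.cyc) (h₂ : f.cyc ≤ Nc)
    (j : BB.Mono ℓ m) :
    decide ((S.toCode.HZ.mulVec (Gen.dataX S (allEventsₛ σ Nc) {f})) j = 1) = synZ S (shapeₛ σ S f).frame.dataXb j := by
  rw [dataXₛ_singleton hσ Nc f h₁ h₂, ← synZ_eq_mulVec]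
  unfold toZ2
  cases synZ S (shapeₛ σ S f).frame.dataXb j <;> decide

/-- The final-layer `X`-detector term of one fault is its residual's true syndrome `synX`. -/
theorem decide_HX_dataZₛ_singleton {σ : SMSchedule} {S : SMCode ℓ m} (hσ : σ.CycleFacts S) (Nc : ℕ) (f : Fault ℓ m) (h₁ : 1 ≤ f.cyc) (h₂ : f.cyc ≤ Nc)
    (i : BB.Mono ℓ m) :
    decide ((S.toCode.HX.mulVec (Gen.dataZ S (allEventsₛ σ Nc) {f})) i = 1) = synX S (shapeₛ σ S f).frame.dataZb i := by
  rw [dataZₛ_singleton hσ Nc f h₁ h₂, ← synX_eq_mulVec]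
  unfold toZ2
  cases synX S (shapeₛ σ S f).frame.dataZb i <;> decide

/-- **COLUMN FORMULA, `Z`-checks.** The `Z`-check detectors fired by one fault of cycle `c ∈ [1, Nc]`: layer `c` reads the
in-cycle flips `μZ`, layer `c+1` reads `μZ ⊕ synZ(Eˣ) ⊕ ζ`, layer `c+2` reads `ζ` (the `ζ`-terms only if cycle `c+1` exists) —
independent of `Nc` except through `[c+1 ≤ Nc]·ζ`; two-layer locality (δ = 1) in crit-1's effective cycles. -/
theorem detZₛ_singleton {σ : SMSchedule} {S : SMCode ℓ m} (hσ : σ.CycleFacts S) (Nc : ℕ) (f : Fault ℓ m) (h₁ : 1 ≤ f.cyc) (h₂ : f.cyc ≤ Nc)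
    (t : ℕ) (j : BB.Mono ℓ m) :
    Gen.detZ S Nc (allEventsₛ σ Nc) {f} t j =
      xor (xor (decide (t = f.cyc) && (shapeₛ σ S f).mZ f.cyc j)
        (decide (t = f.cyc + 1) && xor (xor ((shapeₛ σ S f).mZ f.cyc j) (synZ S (shapeₛ σ S f).frame.dataXb j))
          (decide (f.cyc + 1 ≤ Nc) && (shapeₛ σ S f).frame.ancZx j)))
        (decide (t = f.cyc + 2) && (decide (f.cyc + 1 ≤ Nc) && (shapeₛ σ S f).frame.ancZx j)) := by
  have hμ : ∀ s, s ≠ f.cyc → (shapeₛ σ S f).mZ s j = false := fun s hs => shapeₛ_mZ_of_ne σ S f hs j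
  unfold Gen.detZ
  simp only [Gen.flipZ_singleton, run1ₛ_mZ hσ Nc f h₁ h₂, decide_HZ_dataXₛ_singleton hσ Nc f h₁ h₂]
  set c := f.cyc with hc
  generalize hm : (shapeₛ σ S f).mZ c j = μ
  generalize (shapeₛ σ S f).frame.ancZx j = ζ
  generalize synZ S (shapeₛ σ S f).frame.dataXb j = sy
  by_cases ht0 : t = 0
  · have e1 : ¬ (t = c) := by omega
    have e2 : ¬ (t = c + 1) := by omega
    have e3 : ¬ (t = c + 2) := by omega
    rw [if_pos ht0, decide_eq_false e1, decide_eq_false e2, decide_eq_false e3]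
    cases decide (c + 1 ≤ Nc) <;> cases μ <;> cases ζ <;> cases sy <;> rfl
  rw [if_neg ht0]
  by_cases htN : t ≤ Nc
  · rw [if_pos htN]
    rcases Nat.lt_trichotomy t c with hlt | heq | hgt
    · have e1 : ¬ (c < t ∧ t ≤ Nc) := by omega
      have e2 : ¬ (c < t - 1 ∧ t - 1 ≤ Nc) := by omega
      have e3 : ¬ t = c := by omega
      have e4 : ¬ t = c + 1 := by omega
      have e5 : ¬ t = c + 2 := by omega
      rw [if_neg e1, if_neg e2, hμ t (by omega), hμ (t - 1) (by omega), decide_eq_false e3, decide_eq_false e4,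
        decide_eq_false e5]
      cases decide (c + 1 ≤ Nc) <;> cases μ <;> cases ζ <;> cases sy <;> rfl
    · have e1 : ¬ (c < t ∧ t ≤ Nc) := by omega
      have e2 : ¬ (c < t - 1 ∧ t - 1 ≤ Nc) := by omega
      have e4 : ¬ t = c + 1 := by omega
      have e5 : ¬ t = c + 2 := by omega
      rw [if_neg e1, if_neg e2, decide_eq_false e4, decide_eq_false e5, heq, hm, hμ (c - 1) (by omega), decide_eq_true rfl]
      cases decide (c + 1 ≤ Nc) <;> cases μ <;> cases ζ <;> cases sy <;> rfl
    · have e1 : (c < t ∧ t ≤ Nc) := by omega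
      have e4 : ¬ t = c := by omega
      rw [if_pos e1, decide_eq_false e4]
      by_cases h1 : t = c + 1
      · have e2 : ¬ (c < t - 1 ∧ t - 1 ≤ Nc) := by omega
        have e3 : t - 1 = c := by omega
        have e5 : ¬ t = c + 2 := by omega
        have e6 : c + 1 ≤ Nc := by omega
        rw [if_neg e2, e3, hm, if_pos h1, decide_eq_true h1, decide_eq_false e5, decide_eq_true e6]
        cases μ <;> cases ζ <;> cases sy <;> rfl
      · have e2 : (c < t - 1 ∧ t - 1 ≤ Nc) := by omega
        rw [if_pos e2, if_neg h1, decide_eq_false h1]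
        by_cases h2 : t = c + 2
        · have e3 : t - 1 = c + 1 := by omega
          have e6 : c + 1 ≤ Nc := by omega
          rw [if_pos e3, decide_eq_true h2, decide_eq_true e6]
          cases μ <;> cases ζ <;> cases sy <;> rfl
        · have e3 : ¬ (t - 1 = c + 1) := by omega
          rw [if_neg e3, decide_eq_false h2]
          cases decide (c + 1 ≤ Nc) <;> cases μ <;> cases ζ <;> cases sy <;> rfl
  · rw [if_neg htN]
    have e4 : ¬ t = c := by omega
    rw [decide_eq_false e4]
    by_cases htS : t = Nc + 1
    · rw [if_pos htS]
      rcases Nat.lt_trichotomy Nc (c + 1) with hlt | heq | hgt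
      · have eN : Nc = c := by omega
        have e1 : ¬ (c < Nc ∧ Nc ≤ Nc) := by omega
        have e5 : t = c + 1 := by omega
        have e6 : ¬ t = c + 2 := by omega
        have e7 : ¬ (c + 1 ≤ Nc) := by omega
        rw [if_neg e1, decide_eq_true e5, decide_eq_false e6, decide_eq_false e7, eN, hm]
        cases μ <;> cases ζ <;> cases sy <;> rfl
      · have e1 : (c < Nc ∧ Nc ≤ Nc) := by omega
        have e5 : ¬ t = c + 1 := by omega
        have e6 : t = c + 2 := by omega
        have e7 : (c + 1 ≤ Nc) := by omega
        rw [if_pos e1, if_pos heq, decide_eq_false e5, decide_eq_true e6, decide_eq_true e7]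
        cases μ <;> cases ζ <;> cases sy <;> rfl
      · have e1 : (c < Nc ∧ Nc ≤ Nc) := by omega
        have e2 : ¬ (Nc = c + 1) := by omega
        have e5 : ¬ t = c + 1 := by omega
        have e6 : ¬ t = c + 2 := by omega
        rw [if_pos e1, if_neg e2, decide_eq_false e5, decide_eq_false e6]
        cases decide (c + 1 ≤ Nc) <;> cases μ <;> cases ζ <;> cases sy <;> rfl
    · rw [if_neg htS]
      have e5 : ¬ t = c + 1 := by omega
      rw [decide_eq_false e5]
      by_cases e6 : t = c + 2
      · have e7 : ¬ (c + 1 ≤ Nc) := by omega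
        rw [decide_eq_true e6, decide_eq_false e7]
        cases μ <;> cases ζ <;> cases sy <;> rfl
      · rw [decide_eq_false e6]
        cases decide (c + 1 ≤ Nc) <;> cases μ <;> cases ζ <;> cases sy <;> rfl

/-- **COLUMN FORMULA, `X`-checks.** Layer `c` reads `μX`, layer `c+1` reads `μX ⊕ synX(Eᶻ)`; nothing else — independent of
`Nc`. -/
theorem detXₛ_singleton {σ : SMSchedule} {S : SMCode ℓ m} (hσ : σ.CycleFacts S) (Nc : ℕ) (f : Fault ℓ m) (h₁ : 1 ≤ f.cyc) (h₂ : f.cyc ≤ Nc)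
    (t : ℕ) (i : BB.Mono ℓ m) :
    Gen.detX S Nc (allEventsₛ σ Nc) {f} t i =
      xor (decide (t = f.cyc) && (shapeₛ σ S f).mX f.cyc i)
        (decide (t = f.cyc + 1) && xor ((shapeₛ σ S f).mX f.cyc i) (synX S (shapeₛ σ S f).frame.dataZb i)) := by
  have hμ : ∀ s, s ≠ f.cyc → (shapeₛ σ S f).mX s i = false := fun s hs => shapeₛ_mX_of_ne σ S f hs i
  unfold Gen.detX
  simp only [Gen.flipX_singleton, run1ₛ_mX hσ Nc f h₁ h₂, decide_HX_dataZₛ_singleton hσ Nc f h₁ h₂]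
  set c := f.cyc with hc
  generalize hm : (shapeₛ σ S f).mX c i = μ
  generalize synX S (shapeₛ σ S f).frame.dataZb i = sy
  by_cases ht0 : t = 0
  · have e1 : ¬ (t = c) := by omega
    have e2 : ¬ (t = c + 1) := by omega
    rw [if_pos ht0, decide_eq_false e1, decide_eq_false e2]
    cases μ <;> cases sy <;> rfl
  rw [if_neg ht0]
  by_cases htN : t ≤ Nc
  · rw [if_pos htN]
    rcases Nat.lt_trichotomy t c with hlt | heq | hgt
    · have e1 : ¬ (c < t ∧ t ≤ Nc) := by omega
      have e2 : ¬ (c < t - 1 ∧ t - 1 ≤ Nc) := by omega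
      have e3 : ¬ t = c := by omega
      have e4 : ¬ t = c + 1 := by omega
      rw [if_neg e1, if_neg e2, hμ t (by omega), hμ (t - 1) (by omega), decide_eq_false e3, decide_eq_false e4]
      cases μ <;> cases sy <;> rfl
    · have e1 : ¬ (c < t ∧ t ≤ Nc) := by omega
      have e2 : ¬ (c < t - 1 ∧ t - 1 ≤ Nc) := by omega
      have e4 : ¬ t = c + 1 := by omega
      rw [if_neg e1, if_neg e2, decide_eq_false e4, heq, hm, hμ (c - 1) (by omega), decide_eq_true rfl]
      cases μ <;> cases sy <;> rfl
    · have e1 : (c < t ∧ t ≤ Nc) := by omega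
      have e4 : ¬ t = c := by omega
      rw [if_pos e1, decide_eq_false e4]
      by_cases h1 : t = c + 1
      · have e2 : ¬ (c < t - 1 ∧ t - 1 ≤ Nc) := by omega
        have e3 : t - 1 = c := by omega
        rw [if_neg e2, e3, hm, decide_eq_true h1]
        cases μ <;> cases sy <;> rfl
      · have e2 : (c < t - 1 ∧ t - 1 ≤ Nc) := by omega
        rw [if_pos e2, decide_eq_false h1]
        cases μ <;> cases sy <;> rfl
  · rw [if_neg htN]
    have e4 : ¬ t = c := by omega
    rw [decide_eq_false e4]
    by_cases htS : t = Nc + 1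
    · rw [if_pos htS]
      by_cases hN : Nc = c
      · have e1 : ¬ (c < Nc ∧ Nc ≤ Nc) := by omega
        have e5 : t = c + 1 := by omega
        rw [if_neg e1, decide_eq_true e5, hN, hm]
        cases μ <;> cases sy <;> rfl
      · have e1 : (c < Nc ∧ Nc ≤ Nc) := by omega
        have e5 : ¬ t = c + 1 := by omega
        rw [if_pos e1, decide_eq_false e5]
        cases μ <;> cases sy <;> rfl
    · rw [if_neg htS]
      have e5 : ¬ t = c + 1 := by omega
      rw [decide_eq_false e5]
      cases μ <;> cases sy <;> rfl

end Summit.Ventures.QEC.CircuitDistance
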